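import Mathlib
import Summits.ValiantsHypothesis.ValiantsHypothesis.Theorems.FifoMatchingNNNotVPDivisionSplitDefs
import Literature.Computability.AlgebraicComplexity.IMMInVPProofs
import Literature.Barriers.ValiantsHypothesis.MonotoneGapParseTrees
import HarnessLib

/-!
# Route FifoMatching — crux `NNNotVP` (stmt-ValiantsHypothesis-11615), line `division_split`:
# stub B1 `stub_certificateToSupportFn` (a certificate computes a restricted support function)

Registered line `Cruxes/NNNotVP/Lines/division_split.lean` (crux strategist's BC2 redirect:
`NNNotVP ⟸ ZeroOneTransfer ∧ NNDivisionHard`, the new piece decomposed as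
`A (stub_supportFnHard) → B1 (stub_certificateToSupportFn) → B2 (stub_spreadCofactorReduction)`).
Objects `σ` / `NN` / `SuppFn` / `freeVars` = the line's vocabulary, verbatim, in the companion
`Theorems/FifoMatchingNNNotVPDivisionSplitDefs.lean`. This file proves stub **B1**, verbatim:

* `stub_certificateToSupportFn` — if `x^m` is a monomial of a cofactor `h`, then some `g` (namely
  `g := (NN_n · h)|_{supp m := 1}`) has the support function of `NN_n|_{supp m := 1}` and
  `L₊(g) ≤ L₊(NN_n · h)`.

Proof (the line card's two sentences): over `ℝ≥0` there is no cancellation, so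
`supp (F · H) = supp F + supp H` (the tree's `JerrumSnir.support_mul_eq`); freeing the variables of
`m` is a ring homomorphism and turns `x^m` into a nonzero CONSTANT term of `h|_{supp m := 1}`, so
the monomials of `NN_n|_{supp m := 1}` survive in `g` and every monomial of `g` contains one of
them (exponent supports only grow under addition in `ℕ`); and freeing variables costs no gate
(`complexity_aeval_le` with the free inputs `1 = C 1` and `X v`).

Honest framing: B1 is the «provable engine» of the line — bookkeeping; the line's content stubs
`stub_zeroOneTransfer` (Z), `stub_supportFnHard` (A) and `stub_spreadCofactorReduction` (B2) stay
OPEN, the crux `NNNotVP` stays OPEN, and nothing here is progress on `VP ≠ VNP` (NOT proved).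
No definitions, no named facts.
-/

noncomputable section

-- Sub = Summit single-conjunct layout: the duplicated namespace component is mandated by the tree.
set_option linter.dupNamespace false

namespace Summit.ValiantsHypothesis.ValiantsHypothesis.Theorems.FifoMatching.NNNotVP.DivisionSplit

open MvPolynomial Literature.Computability.AlgebraicComplexity
open scoped NNReal BigOperators Classical

variable {τ : Type*}

/-- Over `ℕ` there is no cancellation of exponents: the support of `a` survives in `a + b`.
[folklore] -/
theorem support_subset_support_add (a b : τ →₀ ℕ) : a.support ⊆ (a + b).support := by
  intro v hv
  rw [Finsupp.mem_support_iff] at hv ⊢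
  simp only [Finsupp.add_apply]
  omega

/-- `freeVars T` (the substitution `x_v := 1`, `v ∈ T`) is a ring homomorphism: it is
multiplicative. [folklore] -/
theorem freeVars_mul (T : Finset τ) (f g : MvPolynomial τ ℝ≥0) :
    freeVars T (f * g) = freeVars T f * freeVars T g := by
  unfold freeVars
  exact map_mul _ _ _

/-- Freeing exactly the variables of a monomial `x^m` of `h` produces a nonzero CONSTANT term:
`x^m ↦ 1`, and over `ℝ≥0` no other monomial can cancel it (the constant coefficient of the image
dominates `coeff m h`). [folklore] -/
theorem zero_mem_support_freeVars (h : MvPolynomial τ ℝ≥0) (m : τ →₀ ℕ) (hm : m ∈ h.support) :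
    (0 : τ →₀ ℕ) ∈ (freeVars m.support h).support := by
  set φ : τ → MvPolynomial τ ℝ≥0 :=
    fun v => if v ∈ m.support then (1 : MvPolynomial τ ℝ≥0) else X v with hφ
  have hexp : freeVars m.support h =
      ∑ d ∈ h.support, C (coeff d h) * ∏ i ∈ d.support, φ i ^ d i := by
    unfold freeVars
    rw [MvPolynomial.aeval_def, MvPolynomial.eval₂_eq]
    rfl
  -- the `d = m` summand is the constant `coeff m h`
  have hprod : ∏ i ∈ m.support, φ i ^ m i = 1 := by
    refine Finset.prod_eq_one fun i hi => ?_
    simp only [hφ, hi, if_true, one_pow]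
  have hterm : coeff 0 (C (coeff m h) * ∏ i ∈ m.support, φ i ^ m i) = coeff m h := by
    rw [hprod, mul_one, coeff_C, if_pos rfl]
  -- nonnegativity: the constant coefficient of the whole sum dominates that summand
  have hle : coeff m h ≤ coeff 0 (freeVars m.support h) := by
    rw [hexp, coeff_sum, ← hterm]
    exact Finset.single_le_sum
      (f := fun d => coeff 0 (C (coeff d h) * ∏ i ∈ d.support, φ i ^ d i))
      (fun _ _ => zero_le) hm
  rw [mem_support_iff] at hm ⊢
  exact (lt_of_lt_of_le (pos_iff_ne_zero.2 hm) hle).ne'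

/-- Freeing variables costs nothing: `L₊(g|_{T := 1}) ≤ L₊(g)` — the inputs `1 = C 1` and `x_v`
are free (`complexity_C_holds`, `complexity_X_holds`) in the substitution bound
`complexity_aeval_le` (Bürgisser 2000 Rem. 2.7). [folklore] -/
theorem complexity_freeVars_le {τ : Type*} [Fintype τ] (T : Finset τ) (g : MvPolynomial τ ℝ≥0) :
    complexity (freeVars T g) ≤ complexity g := by
  unfold freeVars
  refine (complexity_aeval_le _ _).trans ?_
  have h0 : ∀ i : τ, complexity (if i ∈ T then (1 : MvPolynomial τ ℝ≥0) else X i) = 0 := by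
    intro i
    by_cases hi : i ∈ T
    · rw [if_pos hi, ← C_1]; exact complexity_C_holds _
    · rw [if_neg hi]; exact complexity_X_holds _
  simp only [h0, Finset.sum_const_zero, add_zero, le_refl]

/-- **B1 — a certificate computes a restricted support function** (registered obligation
`stub_certificateToSupportFn` of crux `NNNotVP`, line `division_split`; signature verbatim): if
`x^m` is a monomial of `h`, then `g := (NN_n · h)|_{supp m := 1}` has the support function of
`NN_n|_{supp m := 1}` and `L₊(g) ≤ L₊(NN_n · h)`. [folklore] -/
theorem stub_certificateToSupportFn :
    ∀ (n : ℕ) (h : MvPolynomial (σ n) ℝ≥0), ∀ m ∈ h.support,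
      ∃ g : MvPolynomial (σ n) ℝ≥0, (∀ A : Finset (σ n), SuppFn g A ↔ SuppFn (freeVars m.support (NN n)) A) ∧
        complexity g ≤ complexity (NN n * h) := by
  intro n h m hm
  refine ⟨freeVars m.support (NN n * h), fun A => ?_, complexity_freeVars_le _ _⟩
  rw [freeVars_mul]
  constructor
  · rintro ⟨m₀, hm₀, hA⟩
    rw [Literature.Barriers.ValiantsHypothesis.JerrumSnir.support_mul_eq, Finset.mem_add] at hm₀
    obtain ⟨a, ha, b, hb, rfl⟩ := hm₀
    exact ⟨a, ha, (support_subset_support_add a b).trans hA⟩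
  · rintro ⟨a, ha, hA⟩
    refine ⟨a, ?_, hA⟩
    rw [Literature.Barriers.ValiantsHypothesis.JerrumSnir.support_mul_eq, Finset.mem_add]
    exact ⟨a, ha, 0, zero_mem_support_freeVars h m hm, add_zero a⟩

end Summit.ValiantsHypothesis.ValiantsHypothesis.Theorems.FifoMatching.NNNotVP.DivisionSplit

end
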